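import Literature.Probability.LatticeModels.DiscreteIsoperimetry
import Literature.Probability.Percolation.SiteConnectionTools
import HarnessLib

/-!
# Blowing up a finite subset of `ℤ^d` by blocks of odd side `2m+1`

Topic `Literature/Probability/LatticeModels`. For a finite `H ⊆ ℤ^d` and `m : ℕ`, the **blow-up**
`blowUp m H = ⋃_{x ∈ H} ((2m+1) x + [-m, m]^d)` replaces every site of `H` by the block of side
`k = 2m+1` centred at `(2m+1) x`; the blocks tile `ℤ^d`, so

* `card_blowUp` — `|blowUp m H| = (2m+1)^d |H|`;
* `card_boundaryPairs_blowUp_le` — `#∂(blowUp m H) ≤ (2m+1)^{d-1} #∂ H` for the (directed) edge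
  boundary `boundaryPairs` of `DiscreteIsoperimetry.lean`: a boundary edge of the blow-up leaves the
  block of some `x ∈ H` through the face in direction `± eᵢ` towards the block of `x ± eᵢ ∉ H`,
  and each face has `(2m+1)^{d-1}` sites;
* `blowUp_induce_reachable_zero` — if every site of `H ∋ 0` is joined to `0` by a lattice path
  inside `H`, the same holds for `blowUp m H` (inside a block one walks in a translated box,
  `box_induce_reachable`; centres of adjacent blocks are joined along the segment between them).

Consequently the scale-invariant isoperimetric ratio `#∂ H / |H|^{(d-1)/d}` does not increase
under blow-up — the elementary half ("dilating a competitor") of the existence of the limit of the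
rescaled lattice isoperimetric profile, used for the all-open (`p = 1`) case of the anchored
isoperimetric profile (`Literature/Probability/Percolation/AnchoredProfileAllOpen.lean`). Standard
lattice geometry; no named facts.

## Main definitions

* `blockIndex m z` — the index `x` of the block containing `z`: `x i = ⌊(z i + m) / (2m+1)⌋`.
* `block m x = (2m+1) x + [-m, m]^d`, `blowUp m H = ⋃_{x ∈ H} block m x`,
  `face m i b` — the sites of `[-m,m]^d` on the face `{v i = ± m}`.
-/

noncomputable section

open Finset

namespace Literature.Probability.LatticeModels

variable {d : ℕ}

/-! ### Blocks and the block index -/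

/-- The odd side length `2m + 1` of the blocks, as an integer. [folklore] -/
theorem blockSide_pos (m : ℕ) : (0 : ℤ) < 2 * m + 1 := by positivity

/-- The index of the block of side `2m+1` containing `z`: coordinatewise `⌊(z i + m) / (2m+1)⌋`.
[folklore] -/
def blockIndex (m : ℕ) (z : Site d) : Site d := fun i => (z i + m) / (2 * m + 1 : ℤ)

/-- The block of `x` at scale `m`: the box `[-m, m]^d` translated to the centre `(2m+1) x`. [folklore] -/
def block (m : ℕ) (x : Site d) : Finset (Site d) :=
  (box d m).image fun v => v + (2 * m + 1 : ℤ) • x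

/-- Membership in a block: every coordinate is within `m` of the centre. [folklore] -/
theorem mem_block_iff {m : ℕ} {x z : Site d} :
    z ∈ block m x ↔ ∀ i, -(m : ℤ) ≤ z i - (2 * m + 1) * x i ∧ z i - (2 * m + 1) * x i ≤ m := by
  rw [block, mem_image]
  constructor
  · rintro ⟨v, hv, rfl⟩ i
    rw [mem_box] at hv
    simpa using hv i
  · intro h
    refine ⟨z - (2 * m + 1 : ℤ) • x, ?_, sub_add_cancel _ _⟩
    rw [mem_box]
    intro i
    simpa using h i

/-- The coordinatewise characterisation of the block index: `⌊(t + m)/(2m+1)⌋ = a` iff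
`-m ≤ t - (2m+1) a ≤ m`. [folklore] -/
theorem blockIndex_apply_eq_iff {m : ℕ} {z : Site d} {i : Fin d} {a : ℤ} :
    blockIndex m z i = a ↔ -(m : ℤ) ≤ z i - (2 * m + 1) * a ∧ z i - (2 * m + 1) * a ≤ m := by
  rw [blockIndex, Int.ediv_eq_iff_of_pos (blockSide_pos m)]
  constructor
  · rintro ⟨h1, h2⟩; constructor <;> linarith
  · rintro ⟨h1, h2⟩; constructor <;> linarith

/-- `z` lies in the block of `x` iff `x` is the block index of `z`; in particular the blocks tile
`ℤ^d`. [folklore] -/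
theorem mem_block_iff_blockIndex_eq {m : ℕ} {x z : Site d} : z ∈ block m x ↔ blockIndex m z = x := by
  rw [mem_block_iff, funext_iff]
  exact forall_congr' fun i => blockIndex_apply_eq_iff.symm

/-- Every site lies in the block of its index. [folklore] -/
theorem mem_block_blockIndex (m : ℕ) (z : Site d) : z ∈ block m (blockIndex m z) :=
  mem_block_iff_blockIndex_eq.2 rfl

/-- The centre `(2m+1) x` lies in the block of `x`. [folklore] -/
theorem center_mem_block (m : ℕ) (x : Site d) : (2 * m + 1 : ℤ) • x ∈ block m x :=
  mem_image.2 ⟨0, zero_mem_box d m, zero_add _⟩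

/-- Distinct blocks are disjoint. [folklore] -/
theorem disjoint_block {m : ℕ} {x y : Site d} (hxy : x ≠ y) : Disjoint (block m x) (block m y) := by
  rw [Finset.disjoint_left]
  intro z hzx hzy
  exact hxy ((mem_block_iff_blockIndex_eq.1 hzx).symm.trans (mem_block_iff_blockIndex_eq.1 hzy))

/-- A block has `(2m+1)^d` sites. [folklore] -/
theorem card_block (m : ℕ) (x : Site d) : #(block m x) = (2 * m + 1) ^ d := by
  rw [block, card_image_of_injective _ (add_left_injective _), card_box]

/-! ### The blow-up -/

/-- The blow-up of `H` at scale `m`: the union of the blocks of the sites of `H`. [folklore] -/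
def blowUp (m : ℕ) (H : Finset (Site d)) : Finset (Site d) := H.biUnion (block m)

/-- `z ∈ blowUp m H` iff the index of its block lies in `H`. [folklore] -/
theorem mem_blowUp_iff {m : ℕ} {H : Finset (Site d)} {z : Site d} :
    z ∈ blowUp m H ↔ blockIndex m z ∈ H := by
  rw [blowUp, mem_biUnion]
  constructor
  · rintro ⟨x, hx, hz⟩
    rw [mem_block_iff_blockIndex_eq.1 hz]
    exact hx
  · intro h
    exact ⟨_, h, mem_block_blockIndex m z⟩

/-- The block of a site of `H` lies in the blow-up. [folklore] -/
theorem block_subset_blowUp {m : ℕ} {H : Finset (Site d)} {x : Site d} (hx : x ∈ H) :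
    block m x ⊆ blowUp m H := fun _ hz => by
  rwa [mem_blowUp_iff, mem_block_iff_blockIndex_eq.1 hz]

/-- **`|blowUp m H| = (2m+1)^d |H|`** (the blocks are disjoint). [folklore] -/
theorem card_blowUp (m : ℕ) (H : Finset (Site d)) : #(blowUp m H) = (2 * m + 1) ^ d * #H := by
  rw [blowUp, card_biUnion fun x _ y _ hxy => disjoint_block hxy]
  simp_rw [card_block]
  rw [sum_const, smul_eq_mul, mul_comm]

/-! ### Boundary pairs of the blow-up -/

/-- The `i`-th coordinate of the unit step `± eᵢ` is `± 1`, the others vanish. [folklore] -/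
theorem unitStep_apply (i j : Fin d) (b : Bool) :
    unitStep i b j = if j = i then (if b then 1 else -1) else 0 := by
  by_cases h : j = i
  · subst h; simp [unitStep]
  · simp [unitStep, h]

/-- **Where a boundary edge of the blow-up sits.** If `(z, i, b)` is a boundary pair of
`blowUp m H` and `x` is the block index of `z`, then `z` is on the face of its block in direction
`± eᵢ` (`z i - (2m+1) x i = ± m`), the neighbour `z ± eᵢ` has block index `x ± eᵢ`, and
`(x, i, b)` is a boundary pair of `H`. [folklore] -/
theorem boundaryPairs_blowUp_spec {m : ℕ} {H : Finset (Site d)} {t : Site d × Fin d × Bool}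
    (ht : t ∈ boundaryPairs (blowUp m H)) :
    (blockIndex m t.1, t.2.1, t.2.2) ∈ boundaryPairs H ∧
      t.1 t.2.1 - (2 * m + 1) * blockIndex m t.1 t.2.1 = (if t.2.2 then (m : ℤ) else -(m : ℤ)) := by
  obtain ⟨z, i, b⟩ := t
  rw [mem_boundaryPairs] at ht
  obtain ⟨hz, hz'⟩ := ht
  dsimp only at hz hz' ⊢
  rw [mem_blowUp_iff] at hz hz'
  set x := blockIndex m z with hx
  have hzi : -(m : ℤ) ≤ z i - (2 * m + 1) * x i ∧ z i - (2 * m + 1) * x i ≤ m :=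
    blockIndex_apply_eq_iff.1 rfl
  -- the block index of `z ± eᵢ` agrees with `x` off the coordinate `i`
  have hoff : ∀ j, j ≠ i → blockIndex m (z + unitStep i b) j = x j := by
    intro j hj
    have h := (blockIndex_apply_eq_iff (z := z) (i := j)).1 (rfl : blockIndex m z j = x j)
    rw [blockIndex_apply_eq_iff, Pi.add_apply, unitStep_apply, if_neg hj, add_zero]
    exact h
  -- if moreover it agreed at `i`, the neighbour would lie in the blow-up
  have hne : blockIndex m (z + unitStep i b) i ≠ x i := by
    intro h
    apply hz'
    have : blockIndex m (z + unitStep i b) = x := by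
      funext j
      by_cases hj : j = i
      · subst hj; exact h
      · exact hoff j hj
    rw [this]; exact hz
  -- so `z` sits on the `± eᵢ` face and the neighbour's index is `x ± eᵢ`
  have key : z i - (2 * m + 1) * x i = (if b then (m : ℤ) else -(m : ℤ)) ∧
      blockIndex m (z + unitStep i b) i = x i + (if b then 1 else -1) := by
    have hval : (z + unitStep i b) i = z i + (if b then 1 else -1) := by
      rw [Pi.add_apply, unitStep_apply, if_pos rfl]
    cases b with
    | true =>
      simp only [if_true] at hval ⊢
      by_cases hface : z i - (2 * m + 1) * x i = m
      · refine ⟨hface, ?_⟩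
        rw [blockIndex_apply_eq_iff, hval]
        constructor <;> linarith
      · exfalso
        apply hne
        rw [blockIndex_apply_eq_iff, hval]
        constructor
        · linarith [hzi.1]
        · have : z i - (2 * m + 1) * x i < m := lt_of_le_of_ne hzi.2 hface
          linarith
    | false =>
      simp only [Bool.false_eq_true, if_false] at hval ⊢
      by_cases hface : z i - (2 * m + 1) * x i = -m
      · refine ⟨hface, ?_⟩
        rw [blockIndex_apply_eq_iff, hval]
        constructor <;> linarith
      · exfalso
        apply hne
        rw [blockIndex_apply_eq_iff, hval]
        constructor
        · have : -(m : ℤ) < z i - (2 * m + 1) * x i := lt_of_le_of_ne hzi.1 (Ne.symm hface)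
          linarith
        · linarith [hzi.2]
  refine ⟨?_, key.1⟩
  rw [mem_boundaryPairs]
  refine ⟨hz, ?_⟩
  dsimp only
  have hidx : blockIndex m (z + unitStep i b) = x + unitStep i b := by
    funext j
    rw [Pi.add_apply, unitStep_apply]
    by_cases hj : j = i
    · subst hj; rw [if_pos rfl]; exact key.2
    · rw [if_neg hj, add_zero]; exact hoff j hj
  rwa [hidx] at hz'

/-- The face of the box `[-m, m]^d` in direction `± eᵢ`: the sites `v` with `v i = ± m`. [folklore] -/
def face (m : ℕ) (i : Fin d) (b : Bool) : Finset (Site d) :=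
  (box d m).filter fun v => v i = if b then (m : ℤ) else -(m : ℤ)

/-- A face of `[-m, m]^d` has `(2m+1)^{d-1}` sites. [folklore] -/
theorem card_face (m : ℕ) (i : Fin d) (b : Bool) : #(face m i b) = (2 * m + 1) ^ (d - 1) := by
  classical
  set c : ℤ := if b then (m : ℤ) else -(m : ℤ) with hc
  have hcmem : c ∈ Finset.Icc (-(m : ℤ)) m := by
    rw [Finset.mem_Icc]; cases b <;> simp [hc]
  have hface : face m i b =
      Fintype.piFinset (Function.update (fun _ : Fin d => Finset.Icc (-(m : ℤ)) m) i {c}) := by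
    ext v
    simp only [face, mem_filter, mem_box, Fintype.mem_piFinset, ← hc]
    constructor
    · rintro ⟨hv, hvi⟩ j
      by_cases hj : j = i
      · subst hj; rw [Function.update_self, mem_singleton]; exact hvi
      · rw [Function.update_of_ne hj, Finset.mem_Icc]; exact hv j
    · intro hv
      refine ⟨fun j => ?_, ?_⟩
      · by_cases hj : j = i
        · subst hj
          have := hv j
          rw [Function.update_self, mem_singleton] at this
          rw [this]; exact Finset.mem_Icc.1 hcmem
        · have := hv j
          rwa [Function.update_of_ne hj, Finset.mem_Icc] at this
      · have := hv i
        rwa [Function.update_self, mem_singleton] at this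
  rw [hface, Fintype.card_piFinset, Fintype.prod_eq_mul_prod_compl i]
  have h2 : ∀ j ∈ ({i}ᶜ : Finset (Fin d)),
      #(Function.update (fun _ : Fin d => Finset.Icc (-(m : ℤ)) m) i {c} j) = 2 * m + 1 := by
    intro j hj
    rw [Finset.mem_compl, mem_singleton] at hj
    rw [Function.update_of_ne hj, Int.card_Icc]
    omega
  rw [prod_congr rfl h2, prod_const, Finset.card_compl, Fintype.card_fin, card_singleton,
    Function.update_self, card_singleton, one_mul]

/-- **`#∂(blowUp m H) ≤ (2m+1)^{d-1} #∂H`** for the directed edge boundary `boundaryPairs`: the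
boundary pair `(z, i, b)` of the blow-up is recovered from the boundary pair
`(blockIndex z, i, b)` of `H` and the position `z - (2m+1)·blockIndex z` of `z` on the
corresponding face of its block. [folklore] -/
theorem card_boundaryPairs_blowUp_le (m : ℕ) (H : Finset (Site d)) :
    #(boundaryPairs (blowUp m H)) ≤ (2 * m + 1) ^ (d - 1) * #(boundaryPairs H) := by
  classical
  set key : Site d × Fin d × Bool → Site d × Fin d × Bool :=
    fun t => (blockIndex m t.1, t.2.1, t.2.2) with hkey
  have hmaps : Set.MapsTo key (↑(boundaryPairs (blowUp m H)) : Set _) ↑(boundaryPairs H) :=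
    fun t ht => (boundaryPairs_blowUp_spec (Finset.mem_coe.1 ht)).1
  rw [card_eq_sum_card_fiberwise hmaps]
  calc ∑ s ∈ boundaryPairs H, #({t ∈ boundaryPairs (blowUp m H) | key t = s})
      ≤ ∑ s ∈ boundaryPairs H, (2 * m + 1) ^ (d - 1) := by
        refine sum_le_sum fun s _ => ?_
        rw [← card_face m s.2.1 s.2.2]
        refine card_le_card_of_injOn (fun t => t.1 - (2 * m + 1 : ℤ) • blockIndex m t.1) ?_ ?_
        · intro t ht
          rw [Finset.mem_coe, mem_filter] at ht
          obtain ⟨ht, rfl⟩ := ht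
          have hspec := boundaryPairs_blowUp_spec ht
          rw [Finset.mem_coe, face, mem_filter, mem_box]
          refine ⟨fun j => ?_, ?_⟩
          · have := (mem_block_iff (z := t.1)).1 (mem_block_blockIndex m t.1) j
            simpa using this
          · simpa using hspec.2
        · intro t ht t' ht' h
          rw [Finset.mem_coe, mem_filter] at ht ht'
          have hk : key t = key t' := ht.2.trans ht'.2.symm
          simp only [hkey, Prod.mk.injEq] at hk
          obtain ⟨h1, h2, h3⟩ := hk
          dsimp only at h
          rw [h1] at h
          have hz : t.1 = t'.1 := sub_left_injective h
          exact Prod.ext hz (Prod.ext h2 h3)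
    _ = (2 * m + 1) ^ (d - 1) * #(boundaryPairs H) := by rw [sum_const, smul_eq_mul, mul_comm]

/-! ### Connectivity of the blow-up -/

/-- Translation by the centre `(2m+1) x` maps the box `[-m,m]^d` into the blow-up, as a graph
homomorphism of the induced lattice graphs (for `x ∈ H`). [folklore] -/
def boxToBlowUpHom (m : ℕ) {H : Finset (Site d)} {x : Site d} (hx : x ∈ H) :
    (zdGraph d).induce (↑(box d m) : Set (Site d)) →g (zdGraph d).induce (↑(blowUp m H) : Set (Site d)) where
  toFun a := ⟨a.1 + (2 * m + 1 : ℤ) • x,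
    Finset.mem_coe.2 (block_subset_blowUp hx (mem_image.2 ⟨a.1, a.2, rfl⟩))⟩
  map_rel' {a b} hab := by
    change (zdGraph d).Adj (a.1 + (2 * m + 1 : ℤ) • x) (b.1 + (2 * m + 1 : ℤ) • x)
    have := (zdGraph_adj_shift_iff ((2 * m + 1 : ℤ) • x) a.1 b.1).2 hab
    simpa [Site.shift_apply] using this

/-- Inside the blow-up, every site of the block of `x ∈ H` is joined to the centre `(2m+1) x`.
[folklore] -/
theorem blowUp_reachable_center {m : ℕ} {H : Finset (Site d)} {x z : Site d} (hx : x ∈ H)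
    (hz : z ∈ block m x) :
    ((zdGraph d).induce (↑(blowUp m H) : Set (Site d))).Reachable
      ⟨z, Finset.mem_coe.2 (block_subset_blowUp hx hz)⟩
      ⟨(2 * m + 1 : ℤ) • x, Finset.mem_coe.2 (block_subset_blowUp hx (center_mem_block m x))⟩ := by
  obtain ⟨v, hv, rfl⟩ := mem_image.1 hz
  have h := (Percolation.box_induce_reachable m hv (zero_mem_box d m)).map (boxToBlowUpHom m hx)
  have h1 : (boxToBlowUpHom m hx ⟨v, hv⟩ : (↑(blowUp m H) : Set (Site d))) =
      ⟨v + (2 * m + 1 : ℤ) • x, Finset.mem_coe.2 (block_subset_blowUp hx hz)⟩ := rfl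
  have h2 : (boxToBlowUpHom m hx ⟨0, zero_mem_box d m⟩ : (↑(blowUp m H) : Set (Site d))) =
      ⟨(2 * m + 1 : ℤ) • x, Finset.mem_coe.2 (block_subset_blowUp hx (center_mem_block m x))⟩ :=
    Subtype.ext (zero_add _)
  rwa [h1, h2] at h

/-- The points `(2m+1) x + j u`, `0 ≤ j ≤ 2m+1`, of the segment between the centres of the blocks of
adjacent sites `x`, `x + u` of `H` lie in the blow-up (the first `m+1` in the block of `x`, the
others in the block of `x + u`). [folklore] -/
theorem segment_mem_blowUp {m : ℕ} {H : Finset (Site d)} {x : Site d} (hx : x ∈ H) (i : Fin d)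
    (b : Bool) (hy : x + unitStep i b ∈ H) {j : ℕ} (hj : j ≤ 2 * m + 1) :
    (2 * m + 1 : ℤ) • x + (j : ℤ) • unitStep i b ∈ blowUp m H := by
  rw [mem_blowUp_iff]
  by_cases hjm : j ≤ m
  · suffices blockIndex m ((2 * m + 1 : ℤ) • x + (j : ℤ) • unitStep i b) = x by rwa [this]
    funext l
    rw [blockIndex_apply_eq_iff, Pi.add_apply, Pi.smul_apply, Pi.smul_apply, smul_eq_mul,
      smul_eq_mul, unitStep_apply]
    have hjm' : (j : ℤ) ≤ m := by exact_mod_cast hjm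
    split_ifs <;> constructor <;> nlinarith
  · suffices blockIndex m ((2 * m + 1 : ℤ) • x + (j : ℤ) • unitStep i b) = x + unitStep i b by
      rwa [this]
    funext l
    rw [blockIndex_apply_eq_iff, Pi.add_apply, Pi.smul_apply, Pi.smul_apply, smul_eq_mul,
      smul_eq_mul, Pi.add_apply, unitStep_apply]
    have hjm' : (m : ℤ) + 1 ≤ j := by exact_mod_cast Nat.lt_of_not_le hjm
    have hj' : (j : ℤ) ≤ 2 * m + 1 := by exact_mod_cast hj
    split_ifs <;> constructor <;> nlinarith

/-- Inside the blow-up, the centres of the blocks of adjacent sites of `H` are joined (along the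
segment between them). [folklore] -/
theorem blowUp_reachable_centers {m : ℕ} {H : Finset (Site d)} {x : Site d} (hx : x ∈ H)
    (i : Fin d) (b : Bool) (hy : x + unitStep i b ∈ H) :
    ((zdGraph d).induce (↑(blowUp m H) : Set (Site d))).Reachable
      ⟨(2 * m + 1 : ℤ) • x, Finset.mem_coe.2 (block_subset_blowUp hx (center_mem_block m x))⟩
      ⟨(2 * m + 1 : ℤ) • (x + unitStep i b),
        Finset.mem_coe.2 (block_subset_blowUp hy (center_mem_block m _))⟩ := by
  have hmem : ∀ j : ℕ, j ≤ 2 * m + 1 →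
      (2 * m + 1 : ℤ) • x + (j : ℤ) • unitStep i b ∈ (↑(blowUp m H) : Set (Site d)) :=
    fun j hj => Finset.mem_coe.2 (segment_mem_blowUp hx i b hy hj)
  have key : ∀ j : ℕ, ∀ hj : j ≤ 2 * m + 1,
      ((zdGraph d).induce (↑(blowUp m H) : Set (Site d))).Reachable
        ⟨(2 * m + 1 : ℤ) • x, Finset.mem_coe.2 (block_subset_blowUp hx (center_mem_block m x))⟩
        ⟨(2 * m + 1 : ℤ) • x + (j : ℤ) • unitStep i b, hmem j hj⟩ := by
    intro j
    induction j with
    | zero => intro hj; exact ⟨by convert SimpleGraph.Walk.nil using 2; simp⟩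
    | succ j ih =>
      intro hj
      refine (ih (by omega)).trans (SimpleGraph.Adj.reachable ?_)
      change (zdGraph d).Adj ((2 * m + 1 : ℤ) • x + (j : ℤ) • unitStep i b)
        ((2 * m + 1 : ℤ) • x + ((j + 1 : ℕ) : ℤ) • unitStep i b)
      have heq : (2 * m + 1 : ℤ) • x + ((j + 1 : ℕ) : ℤ) • unitStep i b =
          (2 * m + 1 : ℤ) • x + (j : ℤ) • unitStep i b + unitStep i b := by
        rw [Nat.cast_succ, add_smul (j : ℤ) 1 (unitStep i b), one_smul, ← add_assoc]
      rw [heq]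
      exact zdGraph_adj_add_unitStep ((2 * m + 1 : ℤ) • x + (j : ℤ) • unitStep i b) i b
  have h := key (2 * m + 1) le_rfl
  have heq : (2 * m + 1 : ℤ) • x + (((2 * m + 1 : ℕ) : ℤ)) • unitStep i b =
      (2 * m + 1 : ℤ) • (x + unitStep i b) := by
    push_cast; rw [smul_add]
  convert h using 2
  exact heq.symm

/-- **The blow-up of a set connected to `0` through itself is connected to `0` through itself.**
If `0 ∈ H` and every site of `H` is joined to `0` by a lattice path inside `H`, then every site of
`blowUp m H` is joined to `0` by a lattice path inside `blowUp m H`. [folklore] -/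
theorem blowUp_induce_reachable_zero {m : ℕ} {H : Finset (Site d)} (h0 : (0 : Site d) ∈ H)
    (hH : ∀ x (hx : x ∈ H), ((zdGraph d).induce (↑H : Set (Site d))).Reachable
      ⟨0, Finset.mem_coe.2 h0⟩ ⟨x, Finset.mem_coe.2 hx⟩)
    {z : Site d} (hz : z ∈ blowUp m H) :
    ∃ h0' : (0 : Site d) ∈ (↑(blowUp m H) : Set (Site d)),
      ((zdGraph d).induce (↑(blowUp m H) : Set (Site d))).Reachable ⟨0, h0'⟩ ⟨z, Finset.mem_coe.2 hz⟩ := by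
  have hc0 : (0 : Site d) ∈ (↑(blowUp m H) : Set (Site d)) := by
    have := Finset.mem_coe.2 (block_subset_blowUp (m := m) h0 (center_mem_block m 0))
    rwa [smul_zero] at this
  refine ⟨hc0, ?_⟩
  -- centres of sites of `H` joined by a walk of `H` are joined in the blow-up
  have hcen : ∀ x ∈ H, (2 * m + 1 : ℤ) • x ∈ (↑(blowUp m H) : Set (Site d)) := fun x hx =>
    Finset.mem_coe.2 (block_subset_blowUp hx (center_mem_block m x))
  have hwalk : ∀ (a c : (↑H : Set (Site d))) (W : ((zdGraph d).induce (↑H : Set (Site d))).Walk a c),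
      ((zdGraph d).induce (↑(blowUp m H) : Set (Site d))).Reachable
        ⟨(2 * m + 1 : ℤ) • (a : Site d), hcen a a.2⟩ ⟨(2 * m + 1 : ℤ) • (c : Site d), hcen c c.2⟩ := by
    intro a c W
    induction W with
    | nil => exact SimpleGraph.Reachable.refl _
    | @cons u v _ huv _ ih =>
      refine SimpleGraph.Reachable.trans ?_ ih
      obtain ⟨i, hstep | hstep⟩ := (zdGraph_adj_iff u.1 v.1).1 huv
      · -- `v = u + eᵢ`
        have hv : (v : Site d) = (u : Site d) + unitStep i true := by simpa [unitStep] using hstep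
        have hy : (u : Site d) + unitStep i true ∈ H := hv ▸ Finset.mem_coe.1 v.2
        have h := blowUp_reachable_centers (m := m) (Finset.mem_coe.1 u.2) i true hy
        have hvv : (⟨(2 * m + 1 : ℤ) • ((u : Site d) + unitStep i true),
            hcen _ hy⟩ : (↑(blowUp m H) : Set (Site d))) =
            ⟨(2 * m + 1 : ℤ) • (v : Site d), hcen v v.2⟩ :=
          Subtype.ext (show (2 * m + 1 : ℤ) • ((u : Site d) + unitStep i true) =
            (2 * m + 1 : ℤ) • (v : Site d) by rw [hv])
        exact hvv ▸ h
      · -- `u = v + eᵢ`, i.e. `v = u - eᵢ`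
        have hv : (v : Site d) = (u : Site d) + unitStep i false := by
          have : (u : Site d) = (v : Site d) + Pi.single i 1 := hstep
          rw [this]
          funext l
          rw [Pi.add_apply, Pi.add_apply, unitStep_apply]
          by_cases hl : l = i
          · subst hl; simp
          · simp [hl]
        have hy : (u : Site d) + unitStep i false ∈ H := hv ▸ Finset.mem_coe.1 v.2
        have h := blowUp_reachable_centers (m := m) (Finset.mem_coe.1 u.2) i false hy
        have hvv : (⟨(2 * m + 1 : ℤ) • ((u : Site d) + unitStep i false),
            hcen _ hy⟩ : (↑(blowUp m H) : Set (Site d))) =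
            ⟨(2 * m + 1 : ℤ) • (v : Site d), hcen v v.2⟩ :=
          Subtype.ext (show (2 * m + 1 : ℤ) • ((u : Site d) + unitStep i false) =
            (2 * m + 1 : ℤ) • (v : Site d) by rw [hv])
        exact hvv ▸ h
  -- `z` lies in the block of `x := blockIndex z ∈ H`: go `0 → (2m+1)x → z`
  have hx : blockIndex m z ∈ H := mem_blowUp_iff.1 hz
  obtain ⟨W⟩ := hH _ hx
  have h1 := hwalk ⟨0, Finset.mem_coe.2 h0⟩ ⟨blockIndex m z, Finset.mem_coe.2 hx⟩ W
  have h2 := blowUp_reachable_center (m := m) hx (mem_block_blockIndex m z)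
  have h00 : (⟨(2 * m + 1 : ℤ) • ((⟨0, Finset.mem_coe.2 h0⟩ : (↑H : Set (Site d))) : Site d),
      hcen _ h0⟩ : (↑(blowUp m H) : Set (Site d))) = ⟨0, hc0⟩ :=
    Subtype.ext (smul_zero _)
  exact (h00 ▸ h1).trans h2.symm

end Literature.Probability.LatticeModels

end
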